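import Summits.Parity.GeneralizedHardyLittlewood.Theorems.GreenTaoLevelTwoMNTwoDiagonalMajorArc
import Summits.Parity.GeneralizedHardyLittlewood.Theorems.GreenTaoLevelTwoMNTwoDepolarizeSymm
import Summits.Parity.GeneralizedHardyLittlewood.Theorems.GreenTaoLevelTwoMNTwoClearDenominators

/-!
# Route `GreenTaoLevelTwo`, crux `MNTwo` (stmt-Parity-21276), line `birth`, stub `stub_mnVertical`:
# §11 chain, abstract form: dense diagonal set + generators ⇒ uniform major arc (GT 2008b §11)

Block V5 / H5 of the `stub_mnVertical` census (B. Green, T. Tao, *Quadratic uniformity of the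
Möbius function*, Ann. Inst. Fourier 58 (2008) = arXiv:math/0606087, §11: Proposition 25 ⇒
Lemma 26 ⇒ Lemma 27 ⇒ Lemma 28).  This def-free file COMPOSES the three abstract-gauge steps
already in the tree — `…MNTwoDiagonalMajorArc.diagonal_major_arc` (Lemma 26),
`…MNTwoDepolarizeSymm.depolarize_symm` (Lemma 27) and `…MNTwoClearDenominators.clear_denominators`
(Lemma 28, algebraic half) — into one statement: from the output of Proposition 25 (a dense set
`𝒮` of `s` with `‖q_sφ''(s,s)‖ ≤ ε`) and a family of generators `v₀,…,v_{d−1}` of the Bohr set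
`B(ρ₂)`, a SINGLE `q` controls `φ''` on all pairs of integer combinations of the generators.  What
remains for Lemma 28 proper is the geometric fact that every `h ∈ B(ρ₃)` is such a combination with
`Σ|cⱼ|ν(vⱼ) ≲ ν(h)` (the reduced coordinates of the rotation Bohr set).

* `uniform_major_arc_of_dense` — **§11 chain**: `∃ A C` (absolute) such that, with
  `Q₁ = CQ(Q/σ)^A`, `K₁ = C(Q/σ)^A/ρ₁²`, `Q₂ = 25672Q₁⁶`, `K₂ = 426133840896·Q₁¹³K₁`, if
  `18ρ₂ ≤ R` and `648Q₁³K₁ρ₂² ≤ 1` then `∃ 1 ≤ q ≤ Q₂^{d²}` with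
  `‖qφ''(Σcⱼvⱼ, Σc'ⱼvⱼ)‖ ≤ Q₂^{d²}K₂ (Σ|cⱼ|ν(vⱼ))(Σ|c'ⱼ|ν(vⱼ))` whenever both sums are `< ρ₂`.

References: [GreenTao2008QuadraticMobius] arXiv:math/0606087 §11 (Prop. 25, Lemmas 26–28).
-/

noncomputable section

open Finset Real

namespace Summit.Parity.GeneralizedHardyLittlewood.GreenTaoLevelTwoMNTwoUniformMajorArc

open Summit.Parity.GeneralizedHardyLittlewood.GreenTaoLevelTwoMNTwoDiagonalMajorArc
  (diagonal_major_arc)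
open Summit.Parity.GeneralizedHardyLittlewood.GreenTaoLevelTwoMNTwoDepolarizeSymm (depolarize_symm)
open Summit.Parity.GeneralizedHardyLittlewood.GreenTaoLevelTwoMNTwoClearDenominators
  (clear_denominators)

/-- **The §11 chain (GT 2008b Prop. 25 ⇒ Lemma 26 ⇒ Lemma 27 ⇒ Lemma 28), abstract gauge form.**
There are absolute `A ∈ ℕ`, `C ≥ 1` such that the following holds.  Let `ν` be a nonnegative,
symmetric, subadditive, definite gauge with `ν 0 = 0`; `φ : ℤ → ℝ/ℤ` locally quadratic on
`B(n₀,R)`; `0 < ρ₁`, `9ρ₁ ≤ R`, `0 < σ ≤ 1 ≤ Q`, `0 ≤ ε`, `4Qε ≤ σ`; `T` a nonempty finite subset of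
`B(0,2ρ₁)` containing `𝒮 − m` for `ν m ≤ ρ₁`, `σ#T ≤ #𝒮`, every `s ∈ 𝒮` having `1 ≤ q ≤ Q` with
`‖q•φ''(s,s)‖ ≤ ε` (Proposition 25).  Put `Q₁ = CQ(Q/σ)^A`, `K₁ = C(Q/σ)^A/ρ₁²`, and let `ρ₂`
satisfy `18ρ₂ ≤ R`, `648Q₁³K₁ρ₂² ≤ 1`.  Then for any generators `v₀,…,v_{d−1}` with `ν(vⱼ) < ρ₂`
there is ONE `1 ≤ q ≤ (25672Q₁⁶)^{d²}` such that for all integer `c, c'` with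
`Σ|cⱼ|ν(vⱼ) < ρ₂`, `Σ|c'ⱼ|ν(vⱼ) < ρ₂`:
`‖q•φ''(Σcⱼvⱼ, Σc'ⱼvⱼ)‖ ≤ (25672Q₁⁶)^{d²}·(426133840896·Q₁¹³K₁)·(Σ|cⱼ|ν(vⱼ))(Σ|c'ⱼ|ν(vⱼ))`.
[cite: GreenTao2008QuadraticMobius, §11, Lemmas 26, 27, 28] -/
theorem uniform_major_arc_of_dense :
    ∃ (A : ℕ) (C : ℝ), 1 ≤ C ∧
      ∀ (ν : ℤ → ℝ), ν 0 = 0 → (∀ x, 0 ≤ ν x) → (∀ x, ν (-x) = ν x) →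
        (∀ x y, ν (x + y) ≤ ν x + ν y) → (∀ x, ν x = 0 → x = 0) →
      ∀ (φ : ℤ → UnitAddCircle) (n₀ : ℤ) (R : ℝ),
        (∀ n a b c : ℤ, ν (n - n₀) < R → ν (n + a - n₀) < R → ν (n + b - n₀) < R →
          ν (n + c - n₀) < R → ν (n + a + b - n₀) < R → ν (n + a + c - n₀) < R →
          ν (n + b + c - n₀) < R → ν (n + a + b + c - n₀) < R →
          φ (n + a + b + c) - φ (n + a + b) - φ (n + a + c) - φ (n + b + c)
            + φ (n + a) + φ (n + b) + φ (n + c) - φ n = 0) →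
      ∀ (ρ₁ σ ε Q : ℝ) (S T : Finset ℤ), 0 < ρ₁ → 9 * ρ₁ ≤ R → 0 < σ → σ ≤ 1 → 1 ≤ Q →
        0 ≤ ε → 4 * Q * ε ≤ σ → T.Nonempty → (∀ n ∈ T, ν n < 2 * ρ₁) →
        (∀ m : ℤ, ν m ≤ ρ₁ → ∀ s ∈ S, s - m ∈ T) → σ * #T ≤ #S →
        (∀ s ∈ S, ∃ q : ℕ, 1 ≤ q ∧ (q : ℝ) ≤ Q ∧
          ‖((q : ℤ)) • (φ (n₀ + s + s) - φ (n₀ + s) - φ (n₀ + s) + φ n₀)‖ ≤ ε) →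
      ∀ (ρ₂ : ℝ), 18 * ρ₂ ≤ R →
        648 * (C * Q * (Q / σ) ^ A) ^ 3 * (C * (Q / σ) ^ A / ρ₁ ^ 2) * ρ₂ ^ 2 ≤ 1 →
      ∀ (d : ℕ) (v : Fin d → ℤ), (∀ j, ν (v j) < ρ₂) →
        ∃ q : ℕ, 1 ≤ q ∧ (q : ℝ) ≤ (25672 * (C * Q * (Q / σ) ^ A) ^ 6) ^ (d * d) ∧
          ∀ c c' : Fin d → ℤ, ∑ j, |(c j : ℝ)| * ν (v j) < ρ₂ →
            ∑ j, |(c' j : ℝ)| * ν (v j) < ρ₂ →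
            ‖((q : ℤ)) • (φ (n₀ + (∑ j, c j * v j) + ∑ j, c' j * v j) - φ (n₀ + ∑ j, c j * v j) -
                φ (n₀ + ∑ j, c' j * v j) + φ n₀)‖ ≤
              (25672 * (C * Q * (Q / σ) ^ A) ^ 6) ^ (d * d) *
                (426133840896 * (C * Q * (Q / σ) ^ A) ^ 13 * (C * (Q / σ) ^ A / ρ₁ ^ 2)) *
                (∑ j, |(c j : ℝ)| * ν (v j)) * (∑ j, |(c' j : ℝ)| * ν (v j)) := by
  obtain ⟨A, C, hC1, h26⟩ := diagonal_major_arc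
  refine ⟨A, C, hC1, ?_⟩
  intro ν hν0 hνnn hνneg hνadd hνdef φ n₀ R hφ ρ₁ σ ε Q S T hρ₁ hR9 hσ hσ1 hQ hε hQε hT hTball hTS
    hσT hS ρ₂ hR18 hsmall d v hv
  -- Lemma 26: the diagonal major-arc property for every `h`
  have hdiag := h26 ν hν0 hνnn hνadd hνdef φ n₀ R hφ ρ₁ σ ε Q S T hρ₁ hR9 hσ hσ1 hQ hε hQε hT hTball
    hTS hσT hS
  set Q₁ : ℝ := C * Q * (Q / σ) ^ A with hQ₁
  set K₁ : ℝ := C * (Q / σ) ^ A / ρ₁ ^ 2 with hK₁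
  have hQσ : 1 ≤ Q / σ := by rw [le_div_iff₀ hσ]; linarith
  have hQσA : 1 ≤ (Q / σ) ^ A := one_le_pow₀ hQσ
  have hQ₁1 : 1 ≤ Q₁ := by
    have : (1 : ℝ) ≤ C * Q := by nlinarith
    rw [hQ₁]; nlinarith
  have hK₁0 : 0 ≤ K₁ := by rw [hK₁]; positivity
  have h26' : ∀ a : ℤ, ν a < 9 * ρ₂ → ∃ q : ℕ, 1 ≤ q ∧ (q : ℝ) ≤ Q₁ ∧
      ‖((q : ℤ)) • (φ (n₀ + a + a) - φ (n₀ + a) - φ (n₀ + a) + φ n₀)‖ ≤ K₁ * ν a ^ 2 := by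
    intro a _
    obtain ⟨q, hq1, hqQ, hqb⟩ := hdiag a
    refine ⟨q, hq1, hqQ, hqb.trans (le_of_eq ?_)⟩
    rw [hK₁]; ring
  -- Lemma 27 for all pairs in `B(ρ₂)`
  have h27 : ∀ a b : ℤ, ν a < ρ₂ → ν b < ρ₂ → ∃ q : ℕ, 1 ≤ q ∧ (q : ℝ) ≤ 25672 * Q₁ ^ 6 ∧
      ‖((q : ℤ)) • (φ (n₀ + a + b) - φ (n₀ + a) - φ (n₀ + b) + φ n₀)‖ ≤
        (426133840896 * Q₁ ^ 13 * K₁) * ν a * ν b := by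
    intro a b ha hb
    obtain ⟨q, hq1, hqQ, hqb⟩ := depolarize_symm ν hν0 hνnn hνneg hνadd hνdef φ hφ hK₁0 hQ₁1 h26'
      (le_refl _) hR18 hsmall ha hb
    exact ⟨q, hq1, hqQ, by simpa [mul_assoc] using hqb⟩
  -- Lemma 28, algebraic half
  have hQ₂ : (1 : ℝ) ≤ 25672 * Q₁ ^ 6 := by
    have : (1 : ℝ) ≤ Q₁ ^ 6 := one_le_pow₀ hQ₁1; linarith
  have hR3 : 3 * ρ₂ ≤ R := by
    rcases le_or_gt 0 ρ₂ with h | h <;> linarith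
  exact clear_denominators ν hν0 hνnn hνneg hνadd φ hφ hR3 hQ₂ h27 v hv

end Summit.Parity.GeneralizedHardyLittlewood.GreenTaoLevelTwoMNTwoUniformMajorArc
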